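import Mathlib
import Summits.Ventures.PercRepro2.Defs
import Summits.Ventures.PercRepro2.Independence
import Summits.Ventures.PercRepro2.Harris
import Summits.Ventures.PercRepro2.Graph
import Summits.Ventures.PercRepro2.Events
import Summits.Ventures.PercRepro2.ZCZeroWeight
import Summits.Ventures.PercRepro2.ZCReroute
import Summits.Ventures.PercRepro2.ZCContract

/-!
# Series reduction of a non-mark vertex of degree two — the pointwise part (blind cell PercRepro2,
mine-a g26; MINE-A.md §75)

A NON-mark vertex `v` joined to the rest only by `f₁ = xv` and `f₂ = vy`: over the four states of
`(f₁, f₂)` on a configuration `ω₀` closed at `f₁`, `f₂` and at every other edge of `v`, the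
connections between vertices `≠ v` are those of `ω₀` (states `10`, `01`, `00`: `v` is a leaf or
isolated — `ZCZeroWeight`'s leaf lemmas) or those of `ω₀` bridged by `x ↔ y` (state `11` —
`ZCContract`'s `conn_update_true_iff`), which is exactly what the re-routed edge `f₁ ↦ xy` gives
(`conn_series_both`, `conn_series_reroute`; the four correspondences `series_conn_11` … `series_conn_00`).
The probability part and the (ZC) theorem are in `ZCSeries`.  No definition; one seat.
-/

namespace Summit.Ventures.PercRepro2

section SeriesPointwise

variable {V : Type*} {E : Type*} [DecidableEq E] {ends : E → Sym2 V} {x v y : V} {f₁ f₂ : E}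

/-- The four states of two edges on a base configuration closed at both. -/
lemma update_two_eq_state (hf : f₁ ≠ f₂) (ω : Config E) (b₁ b₂ : Bool) :
    Function.update (Function.update ω f₁ b₁) f₂ b₂ =
      Function.update (Function.update (Function.update (Function.update ω f₁ false) f₂ false) f₁ b₁)
        f₂ b₂ := by
  funext e
  by_cases h₂ : e = f₂
  · subst h₂; simp
  · by_cases h₁ : e = f₁
    · subst h₁; simp [Function.update_of_ne hf]
    · simp [Function.update_of_ne h₁, Function.update_of_ne h₂]

/-- Closing a closed edge does nothing. -/
lemma update_false_of_eq_false {ω : Config E} {f : E} (h : ω f = false) :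
    Function.update ω f false = ω := by
  conv_lhs => rw [← h]
  exact Function.update_eq_self f ω

variable (hf₁ : ends f₁ = s(x, v)) (hf₂ : ends f₂ = s(v, y)) (hxv : x ≠ v) (hyv : y ≠ v)
  (hf : f₁ ≠ f₂) {ω₀ : Config E} (h₀₁ : ω₀ f₁ = false) (h₀₂ : ω₀ f₂ = false)
  (hω₀ : ∀ e, v ∈ ends e → e = f₁ ∨ e = f₂ ∨ ω₀ e = false)

include h₀₂ hω₀ in
/-- In the state `10` every edge at `v` other than `f₁` is closed. -/
lemma series_leaf_x_closed : ∀ e, v ∈ ends e → e = f₁ ∨ Function.update ω₀ f₁ true e = false := by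
  intro e he
  by_cases h₁ : e = f₁
  · exact Or.inl h₁
  · right
    rw [Function.update_of_ne h₁]
    rcases hω₀ e he with h | h | h
    · exact absurd h h₁
    · rw [h]; exact h₀₂
    · exact h

include h₀₁ hω₀ in
/-- In the state `01` every edge at `v` other than `f₂` is closed. -/
lemma series_leaf_y_closed : ∀ e, v ∈ ends e → e = f₂ ∨ Function.update ω₀ f₂ true e = false := by
  intro e he
  by_cases h₂ : e = f₂
  · exact Or.inl h₂
  · right
    rw [Function.update_of_ne h₂]
    rcases hω₀ e he with h | h | h
    · rw [h]; exact h₀₁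
    · exact absurd h h₂
    · exact h

include hf₁ hxv h₀₁ h₀₂ hω₀ in
/-- State `10` (`v` a leaf at `x`): connections between vertices `≠ v` are those of `ω₀`. -/
lemma conn_series_leaf_x {u u' : V} (hu : u ≠ v) (hu' : u' ≠ v) :
    Conn ends (Function.update ω₀ f₁ true) u u' ↔ Conn ends ω₀ u u' := by
  have h := conn_leaf_iff_of_ne' hf₁ hxv (series_leaf_x_closed h₀₂ hω₀) hu hu'
  rwa [Function.update_idem, update_false_of_eq_false h₀₁] at h

include hf₂ hyv h₀₁ h₀₂ hω₀ in
/-- State `01` (`v` a leaf at `y`): connections between vertices `≠ v` are those of `ω₀`. -/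
lemma conn_series_leaf_y {u u' : V} (hu : u ≠ v) (hu' : u' ≠ v) :
    Conn ends (Function.update ω₀ f₂ true) u u' ↔ Conn ends ω₀ u u' := by
  have hf₂' : ends f₂ = s(y, v) := by rw [hf₂, Sym2.eq_swap]
  have h := conn_leaf_iff_of_ne' hf₂' hyv (series_leaf_y_closed h₀₁ hω₀) hu hu'
  rwa [Function.update_idem, update_false_of_eq_false h₀₂] at h

include hf₁ hxv h₀₁ h₀₂ hω₀ in
/-- State `10`: `u ↔ v` iff `u ↔ x` in `ω₀` (for `u ≠ v`). -/
lemma conn_series_leaf_x_v {u : V} (hu : u ≠ v) :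
    Conn ends (Function.update ω₀ f₁ true) u v ↔ Conn ends ω₀ u x := by
  have h := conn_leaf_iff' hf₁ hxv (series_leaf_x_closed h₀₂ hω₀) hu
  rw [Function.update_idem, update_false_of_eq_false h₀₁, Function.update_self] at h
  rw [h]
  simp

include hf₁ hf₂ hxv hyv hf h₀₁ h₀₂ hω₀ in
/-- **State `11` (both edges open): the connections between vertices `≠ v` are those of `ω₀`
bridged by `x ↔ y`.** -/
lemma conn_series_both {u u' : V} (hu : u ≠ v) (hu' : u' ≠ v) :
    Conn ends (Function.update (Function.update ω₀ f₁ true) f₂ true) u u' ↔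
      Conn ends ω₀ u u' ∨ (Conn ends ω₀ u x ∧ Conn ends ω₀ y u') ∨
        (Conn ends ω₀ u y ∧ Conn ends ω₀ x u') := by
  have h₁₂ : Function.update ω₀ f₁ true f₂ = false := by rw [Function.update_of_ne hf.symm]; exact h₀₂
  have h := conn_update_true_iff hf₂ (Function.update ω₀ f₁ true) u u'
  rw [update_false_of_eq_false h₁₂] at h
  rw [h, conn_series_leaf_x hf₁ hxv h₀₁ h₀₂ hω₀ hu hu',
    conn_series_leaf_x_v hf₁ hxv h₀₁ h₀₂ hω₀ hu,
    conn_series_leaf_x hf₁ hxv h₀₁ h₀₂ hω₀ hyv hu',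
    conn_series_leaf_x hf₁ hxv h₀₁ h₀₂ hω₀ hu hyv]
  have hv : Conn ends (Function.update ω₀ f₁ true) v u' ↔ Conn ends ω₀ x u' := by
    constructor
    · intro hc
      exact conn_symm ((conn_series_leaf_x_v hf₁ hxv h₀₁ h₀₂ hω₀ hu').1 (conn_symm hc))
    · intro hc
      exact conn_symm ((conn_series_leaf_x_v hf₁ hxv h₀₁ h₀₂ hω₀ hu').2 (conn_symm hc))
  rw [hv]

/-- The re-routed endpoint map: `f₁` becomes the edge `xy`. -/
lemma conn_reroute_closed (ω : Config E) (hω : ω f₁ = false) (u u' : V) :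
    Conn (Function.update ends f₁ s(x, y)) ω u u' ↔ Conn ends ω u u' := by
  refine (conn_congr_of_closed (Z := {f₁}) (ends := Function.update ends f₁ s(x, y)) (ends' := ends)
    ?_ ?_ u u')
  · intro e he
    rw [Function.update_of_ne (by simpa using he)]
  · intro e he
    rw [Set.mem_singleton_iff.1 he]; exact hω

include h₀₁ in
/-- **The re-routed graph in its state `1` (edge `xy` open) has the bridged connections of `ω₀`.** -/
lemma conn_series_reroute (u u' : V) :
    Conn (Function.update ends f₁ s(x, y)) (Function.update ω₀ f₁ true) u u' ↔
      Conn ends ω₀ u u' ∨ (Conn ends ω₀ u x ∧ Conn ends ω₀ y u') ∨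
        (Conn ends ω₀ u y ∧ Conn ends ω₀ x u') := by
  have h := conn_update_true_iff (ends := Function.update ends f₁ s(x, y)) (f := f₁)
    (Function.update_self f₁ s(x, y) ends) ω₀ u u'
  rw [update_false_of_eq_false h₀₁] at h
  rw [h, conn_reroute_closed ω₀ h₀₁, conn_reroute_closed ω₀ h₀₁, conn_reroute_closed ω₀ h₀₁,
    conn_reroute_closed ω₀ h₀₁, conn_reroute_closed ω₀ h₀₁]

end SeriesPointwise

section SeriesZC

variable {V : Type*} {E : Type*} [DecidableEq E] {ends : E → Sym2 V} {x v y : V} {f₁ f₂ : E}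

omit [DecidableEq E] in
/-- Clusters that agree off `v` as connection predicates agree off `v` as sets. -/
lemma cluster_sdiff_eq_of_conn_iff {ends' : E → Sym2 V} {ω ω' : Config E} {a : V}
    (h : ∀ u, u ≠ v → (Conn ends ω a u ↔ Conn ends' ω' a u)) :
    cluster ends ω a \ {v} = cluster ends' ω' a \ {v} := by
  ext u
  simp only [Set.mem_sdiff, Set.mem_singleton_iff, mem_cluster]
  constructor
  · rintro ⟨h1, h2⟩; exact ⟨(h u h2).1 h1, h2⟩
  · rintro ⟨h1, h2⟩; exact ⟨(h u h2).2 h1, h2⟩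

omit [DecidableEq E] in
/-- A `v`-blind cluster up-set sees only the cluster off `v`. -/
lemma clusterInEvent_iff_of_blind {ends' : E → Sym2 V} {ω ω' : Config E} {a : V}
    (h : ∀ u, u ≠ v → (Conn ends ω a u ↔ Conn ends' ω' a u)) {𝓔 : Set (Set V)}
    (hblind : ∀ S, S ∈ 𝓔 ↔ S \ {v} ∈ 𝓔) :
    ω ∈ clusterInEvent ends a 𝓔 ↔ ω' ∈ clusterInEvent ends' a 𝓔 := by
  simp only [clusterInEvent, Set.mem_setOf_eq]
  rw [hblind, cluster_sdiff_eq_of_conn_iff h, ← hblind]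

variable (hf₁ : ends f₁ = s(x, v)) (hf₂ : ends f₂ = s(v, y)) (hxv : x ≠ v) (hyv : y ≠ v)
  (hf : f₁ ≠ f₂) {ω₀ : Config E} (h₀₁ : ω₀ f₁ = false) (h₀₂ : ω₀ f₂ = false)
  (hω₀ : ∀ e, v ∈ ends e → e = f₁ ∨ e = f₂ ∨ ω₀ e = false)

include hf₁ hf₂ hxv hyv hf h₀₁ h₀₂ hω₀ in
/-- State `11` of `G` ↔ state `1` of the re-routed graph, for connections between vertices `≠ v`. -/
lemma series_conn_11 {u u' : V} (hu : u ≠ v) (hu' : u' ≠ v) :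
    Conn ends (Function.update (Function.update ω₀ f₁ true) f₂ true) u u' ↔
      Conn (Function.update ends f₁ s(x, y)) (Function.update ω₀ f₁ true) u u' := by
  rw [conn_series_both hf₁ hf₂ hxv hyv hf h₀₁ h₀₂ hω₀ hu hu', conn_series_reroute h₀₁]

include hf₁ hxv h₀₁ h₀₂ hω₀ in
/-- State `10` of `G` ↔ state `0` of the re-routed graph. -/
lemma series_conn_10 {u u' : V} (hu : u ≠ v) (hu' : u' ≠ v) :
    Conn ends (Function.update ω₀ f₁ true) u u' ↔
      Conn (Function.update ends f₁ s(x, y)) ω₀ u u' := by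
  rw [conn_series_leaf_x hf₁ hxv h₀₁ h₀₂ hω₀ hu hu', conn_reroute_closed ω₀ h₀₁]

include hf₂ hyv h₀₁ h₀₂ hω₀ in
/-- State `01` of `G` ↔ state `0` of the re-routed graph. -/
lemma series_conn_01 {u u' : V} (hu : u ≠ v) (hu' : u' ≠ v) :
    Conn ends (Function.update ω₀ f₂ true) u u' ↔
      Conn (Function.update ends f₁ s(x, y)) ω₀ u u' := by
  rw [conn_series_leaf_y hf₂ hyv h₀₁ h₀₂ hω₀ hu hu', conn_reroute_closed ω₀ h₀₁]

include h₀₁ in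
/-- State `00` of `G` ↔ state `0` of the re-routed graph. -/
lemma series_conn_00 (u u' : V) :
    Conn ends ω₀ u u' ↔ Conn (Function.update ends f₁ s(x, y)) ω₀ u u' := by
  rw [conn_reroute_closed ω₀ h₀₁]

end SeriesZC


end Summit.Ventures.PercRepro2
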